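import Mathlib
import HarnessLib
import Summits.HubbardSuperconductivity.HubbardSuperconductivity.Theorems.KLProgrammeKLRegimeSectorSliceGramFat

/-!
# Route `KLProgramme` — engine / VL support, FAT layer: the TIME-SECTION and SPACE-SECTION support counts of one fat multiplier
# (the two counts the SECTIONAL weighted row `…SectorSlicePairSectional.slicePairWt_charSum_l1_sectional_le` reads)

Cell `gate-hubbard-kl`, seat p3 (g11), for the «sectional row `eW′`» in the sector currency (k3c4-p1 M3b-j (ii)).  `…SectorSliceGramFat.card_support_bgmFat_le`
counts the support of `F̃_ω` on the product torus as (time window) × (spatial cell); the sectional assembly needs the two factors SEPARATELY: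

* **`card_timeSections_bgmFat_le`** — the number of time labels `q₁` at which `F̃_ω(q₁, ·)` is not identically zero is `≤ Λ_m β/π + 3`
  (`bgmFat_support_shell` + `card_filter_matsubaraFreq_le`);
* **`card_spaceSection_bgmFat_le`** — at EVERY frequency `i`, `#{k⃗ : F̃_ω(i, k⃗) ≠ 0} ≤ (√2·L·(Λ_m + (4+4A)ρ²)/((2ρ_min − 4A)π) + 2)·(√2·L·2ρ/π + 2)`,
  `ρ = ρ₀ + δ_F` as in `card_support_bgmFat_le` (`bgmFat_support_shell/angle` + `frameBand_cell` + `norm_klFermiPoint_fatNbr_sub_le` + `card_filter_cell_le`).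

Everything is proved; no definitions; nothing about the model is asserted. [cite: BenfattoGiulianiMastropietro2006, §2.5 (2.50), §2.7 (2.66), (2.69)]
-/

noncomputable section

namespace Summit.HubbardSuperconductivity.HubbardSuperconductivity.Theorems.TorusFourierL2

set_option linter.dupNamespace false -- summit = problem name (single-conjunct summit), D-0017

open Set Finset Literature.MathematicalPhysics.QuantumLattice Literature.MathematicalPhysics.QuantumLattice.BandSectorCounting
open Literature.MathematicalPhysics.QuantumLattice.FermiRG Literature.Probability.LatticeModels Literature.Analysis.SpecialFunctions
open Summit.HubbardSuperconductivity.HubbardSuperconductivity.Theorems.DispersionFlow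
open Summit.HubbardSuperconductivity.HubbardSuperconductivity.Theorems.KLRegimeSplit
open Summit.HubbardSuperconductivity.HubbardSuperconductivity.Theorems.KLProgrammeLegKernels
open Summit.HubbardSuperconductivity.HubbardSuperconductivity.Theorems.PerturbedFermiCurve
open scoped Real Nat

section FatSections

open Classical

variable {L M : ℕ} [NeZero L] [NeZero M]

/-- **Time sections of one fat multiplier**: the time labels carrying a non-zero value are in the Matsubara window `|ω| ≤ Λ_m`, hence
`≤ Λ_m β/π + 3` of them. [cite: BenfattoGiulianiMastropietro2006, §2.5 (2.50), §2.7 (2.66)] -/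
theorem card_timeSections_bgmFat_le {μ e₀ β : ℝ} (he : 0 < e₀) (hβ : 0 < β) (K : TrigPolyC4v) (m : ℕ) (ω : Fin (sectorCount (m + 1))) :
    (((univ : Finset (TorusSite 1 (2 * M))).filter fun q₁ => ∃ k : TorusSite 2 L,
        bgmFatMultiplier L M e₀ β (nambuXiCT L μ K) (m + 1) ω (⟨(q₁ 0).val, ZMod.val_lt (q₁ 0)⟩, k) ≠ 0).card : ℝ) ≤
      klScale e₀ m * β / π + 3 := by
  set T := (univ : Finset (TorusSite 1 (2 * M))).filter fun q₁ => ∃ k : TorusSite 2 L,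
    bgmFatMultiplier L M e₀ β (nambuXiCT L μ K) (m + 1) ω (⟨(q₁ 0).val, ZMod.val_lt (q₁ 0)⟩, k) ≠ 0 with hT
  have hΛ0 : 0 < klScale e₀ m := by rw [klScale]; positivity
  set f : TorusSite 1 (2 * M) → MatsubaraIdx M := fun q₁ => ⟨(q₁ 0).val, ZMod.val_lt (q₁ 0)⟩ with hf
  have hinj : Set.InjOn f T := by
    intro q₁ _ q₁' _ h
    have hv : (q₁ 0).val = (q₁' 0).val := by
      have := congrArg Fin.val h
      simpa [hf] using this
    funext j
    have hj : j = 0 := Subsingleton.elim _ _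
    subst hj
    exact ZMod.val_injective _ hv
  rw [← card_image_of_injOn hinj]
  refine card_filter_matsubaraFreq_le hβ hΛ0.le _ fun i hi => ?_
  obtain ⟨q₁, hq₁, rfl⟩ := mem_image.1 hi
  obtain ⟨k, hk⟩ := (mem_filter.1 hq₁).2
  have hsh := bgmFat_support_shell (L := L) (M := M) (μ := μ) (β := β) he m ω (f q₁, k) hk
  have h1 : matsubaraFreq β M (f q₁) ^ 2 ≤ klScale e₀ m ^ 2 := le_trans (le_add_of_nonneg_right (sq_nonneg _)) hsh
  rw [← Real.sqrt_sq_eq_abs, ← Real.sqrt_sq hΛ0.le]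
  exact Real.sqrt_le_sqrt h1

variable {a b : ℝ} (B : BandBounds a b) {K : TrigPolyC4v} {A : ℝ}
  (hA : ∀ p : Momentum, ∀ j ≤ 2, ‖iteratedFDeriv ℝ j (frameShift K) p‖ ≤ A) (hADt : 2 * A < B.Dtmin)
  {μ e₀ z β : ℝ} (he : 0 < e₀) (hz : 0 < z) (hz1 : z ≤ 1) (hgap : e₀ + A + z ^ 2 < -μ)
  (hlo : a ≤ μ - A - e₀) (hhi : μ + A + e₀ ≤ b) (hρA : 4 * A < 2 * B.rhomin) (m : ℕ)

include B hA hADt he hz hz1 hgap hlo hhi hρA in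
omit [NeZero M] in
/-- **Space section of one fat multiplier at a fixed frequency**: `#{k⃗ : F̃_ω(i, k⃗) ≠ 0}` is at most the spatial cell count of
`card_support_bgmFat_le` (uniform in the frequency `i` and the sector `ω`). [cite: BenfattoGiulianiMastropietro2006, §2.7 (2.66), (2.69)] -/
theorem card_spaceSection_bgmFat_le (ω : Fin (sectorCount (m + 1))) (i : MatsubaraIdx M) :
    (((univ : Finset (TorusSite 2 L)).filter fun k => bgmFatMultiplier L M e₀ β (nambuXiCT L μ K) (m + 1) ω (i, k) ≠ 0).card : ℝ) ≤
      (Real.sqrt 2 * L * ((klScale e₀ m + (4 + 4 * A) *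
          ((klScale e₀ m + B.smax * B.Dtmin * (3 * sectorWidth (m + 1) / 4)) / (B.Dtmin - 2 * A) +
            π * Real.sqrt 2 * (1 + (4 + 2 * A) / (B.Dtmin - 2 * A)) * sectorWidth (m + 1)) ^ 2) / (2 * B.rhomin - 4 * A)) / π + 2) *
        (Real.sqrt 2 * L * (2 * ((klScale e₀ m + B.smax * B.Dtmin * (3 * sectorWidth (m + 1) / 4)) / (B.Dtmin - 2 * A) +
            π * Real.sqrt 2 * (1 + (4 + 2 * A) / (B.Dtmin - 2 * A)) * sectorWidth (m + 1))) / π + 2) := by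
  have hlo' : a ≤ μ - A := by linarith only [hlo, he]
  have hhi' : μ + A ≤ b := by linarith only [hhi, he]
  have hDt : 0 < B.Dtmin - 2 * A := by linarith only [hADt]
  have hγ : 0 < 2 * B.rhomin - 4 * A := by linarith only [hρA]
  have hΛ0 : 0 < klScale e₀ m := by rw [klScale]; positivity
  have hΛe : klScale e₀ m ≤ e₀ := klScale_le_e0 he.le m
  have hA0 : 0 ≤ A := (norm_nonneg _).trans (hA 0 0 (by norm_num))
  set ρ₀ : ℝ := (klScale e₀ m + B.smax * B.Dtmin * (3 * sectorWidth (m + 1) / 4)) / (B.Dtmin - 2 * A) with hρ₀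
  set δF : ℝ := π * Real.sqrt 2 * (1 + (4 + 2 * A) / (B.Dtmin - 2 * A)) * sectorWidth (m + 1) with hδF
  have hρ₀0 : 0 ≤ ρ₀ := by rw [hρ₀]; have := B.smax_pos; have := B.Dtmin_pos; have := sectorWidth_pos (m + 1); positivity
  have hδF0 : 0 ≤ δF := by rw [hδF]; have := sectorWidth_pos (m + 1); positivity
  have hρ0 : 0 ≤ ρ₀ + δF := add_nonneg hρ₀0 hδF0
  set pF : Fin 2 → ℝ := klFermiPoint μ K (sectorCenter (m + 1) (ω : ℕ)) with hpF
  refine le_trans (card_filter_cell_le L (contDiff_frameBand μ K) (norm_iteratedFDeriv_two_frameBand_le hA μ)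
    (pF := pF) (frameLevel_klFermiPoint B hA hlo' hhi' (sectorCenter (m + 1) (ω : ℕ))) hΛ0.le hρ0 hγ
    (gradient_floor_klFermiPoint B hA hlo' hhi' (sectorCenter (m + 1) (ω : ℕ))) _ ?_) (le_of_eq ?_)
  · intro k hk
    have hne := (mem_filter.1 hk).2
    -- the centred representative and its two descriptions
    have e : (fun j => 2 * π * (((k j).valMinAbs : ℤ) : ℝ) / L) = torusCentredMomentum L k := by
      rw [torusCentredMomentum_eq_valMinAbs]; funext j; ring
    rw [e]
    -- shell
    have hsh := bgmFat_support_shell (L := L) (M := M) (μ := μ) (β := β) he m ω (i, k) hne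
    have hξ : nambuXiCT L μ K k ^ 2 ≤ klScale e₀ m ^ 2 := le_trans (le_add_of_nonneg_left (sq_nonneg _)) hsh
    have hshell : |frameLevel μ K (WithLp.toLp 2 (torusCentredMomentum L k))| ≤ klScale e₀ m := by
      rw [← nambuXiCT_eq_frameLevel, ← Real.sqrt_sq_eq_abs, ← Real.sqrt_sq hΛ0.le]
      exact Real.sqrt_le_sqrt hξ
    -- angle
    obtain ⟨a', ha', hζ⟩ := bgmFat_support_angle (L := L) (M := M) (μ := μ) (e₀ := e₀) (β := β) (K := K) m ω (i, k) hne
    have hsq : ∀ j, |torusCentredMomentum L k j| ≤ π + z := fun j => (abs_torusCentredMomentum_le_pi L k j).trans (by linarith only [hz])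
    have hcell := frameBand_cell B hA hADt hz.le hz1 (Λ := klScale e₀ m) (by linarith only [hgap, hΛe]) (by linarith only [hlo, hΛe])
      (by linarith only [hhi, hΛe]) (m + 1) a' hsq hshell hζ
    have hδ := norm_klFermiPoint_fatNbr_sub_le B hA hlo' hhi' hADt (m + 1) (ω : ℕ) ha'
    refine ⟨hshell, ?_⟩
    calc ‖torusCentredMomentum L k - pF‖
        = ‖(torusCentredMomentum L k - klFermiPoint μ K (sectorCenter (m + 1) a')) +
            (klFermiPoint μ K (sectorCenter (m + 1) a') - pF)‖ := by congr 1; abel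
      _ ≤ ρ₀ + δF := (norm_add_le _ _).trans (add_le_add hcell hδ)
  · rw [hρ₀, hδF]

end FatSections

end Summit.HubbardSuperconductivity.HubbardSuperconductivity.Theorems.TorusFourierL2

end
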